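import Literature.MathematicalPhysics.QuantumFieldTheory.Balaban1983to89.B8Eq143PlaqExpansion
import HarnessLib

/-!
# Route `UnitScaleTilt`, crux K1 «MinimiserStabilityRegPr» (stmt-QuantumFields-19200) — route-R E′ (A′), LANE II «DIVERGENCE RECOVERY AT CURVED `W`» (★★OWNER RULING №23),
# brick (B2a), sub-pen F4 (★p1 g19 NAMER WORD №6 (3)), FILE F4-A: **THE COVARIANT TENT QUASI-INTERPOLANT — POINTWISE (GENERIC) ROWS**

Cell `ym3-torus` ∕ width seat `ym3-torus-px3` (gen 6).  THEOREMS ONLY (0 `def`, 0 `sorry`), GENERIC over a normed ring `𝔸` with `‖1‖ = 1` (at the member: `M₂(ℂ)` with the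
operator norm); `--supports stmt-QuantumFields-19200 --as helper`, count-neutral.  YM₃ on T³ is a ladder rung (R3), not d = 4, not the Clay problem; nothing here claims
[Balaban1985BackgroundPropagators] Thm 3.11, `hN06`, (REC), E′, EX or the gap.

THE OBJECT (★p1 g19 SIGNATURE-0 (B2a), construction «`J := I_σ + J⁰_σ∘N∘(1 − Q′I_σ)`»; this file = the pointwise algebra of `I_σ`).  A coarse function `w : ι → 𝔸` (values at the
coarse sites `y`), a finite set `S` of coarse sites near a fine site, a partition of unity `β` (`Σ_{y∈S} β y = 1`, `β ≥ 0`), and FRAMES `g y ∈ 𝔸ˣ` (at the member: the one-shot axial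
transporter from the corner of box `y` to the fine site).  The covariant tent value at the fine site is `Σ_{y∈S} β y • Ad(g y)⁻¹ (w y)` (`Ad = conjR`).  Across a fine bond `b = (s, t)` with
bond variable `W_b` the covariant difference `Ad(W_b)(value at t) − (value at s)` is controlled by (§2):
* the SLOPES `|β_t y − β_s y|` times the COARSE COVARIANT DIFFERENCES `‖Ad(P y) w(y) − w(y₀)‖` to a reference block `y₀` through coarse transporters `P y` (at the member: products of
  ≤ 3 inverse (B3)-transporters `T c` along a monotone coarse path), plus
* the THIN-loop defects `‖g_s y · W_b · (g_t y)⁻¹ − 1‖ ≤ θ₁` (axial gauge: lit ✓`B8Lemma1NonAbelian.axial_bond_bound_sharp`) and the FAT-loop defects `‖g_s y₀ · (g_s y)⁻¹ − P y‖ ≤ θ₂`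
  (two corner-rooted axial transports vs the straight corner-to-corner transport), both weighted by `‖w‖`.
The REPRODUCTION defect of a transported block average (print's comb average `Q′`, (3.19)) and the SIZE are controlled in the same currency (§3, §4); §5 squares the three rows
(Jensen ∕ Cauchy–Schwarz) into the shape summed at the member by FILE F4-B.

CONTENTS (ns `…Theorems.Prop7CovariantTentPointwise`):
* §1 `norm_conjR_sub_conjR_le` (`‖Ad(u)X − Ad(p)X‖ ≤ 2‖u − p‖‖X‖` on `U1`), `norm_mul_sub_le_add` (chaining two near-relations), `sum_smul_sub_ref` (reference subtraction under
  `Σβ_t = Σβ_s`), `norm_conjR_inv_sub_eq`, ★ `norm_conjR_inv_mul_sub_le` ∕ `norm_conjR_inv_mul₃_sub_le` (coarse-path telescoping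
  of `Ad(T c₁⋯T c_j)⁻¹` against the one-bond covariant differences, `j ≤ 3`).
* §2 ★★ `covTent_grad_identity`, ★★★ `norm_covTent_grad_le` — the per-bond gradient row.
* §3 ★★ `norm_sub_avg_covTent_le` — the per-block reproduction row.
* §4 ★ `norm_covTent_le` — the pointwise size row.
* §5 `sq_sum_mul_le_of_abs_le`, `sq_sum_convex_le`, `sq_sum_subconvex_le`, ★ `norm_sq_covTent_grad_le`, ★ `norm_sq_sub_avg_covTent_le`, ★ `norm_sq_covTent_le` — squared forms.
HONEST SCOPE.  Finite sums and the triangle inequality in a normed ring; no lattice, no estimate of print; rung R3, not Clay; YM gap NOT proved.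

References: T. Bałaban, CMP **99** (1985) 389–434 [Balaban1985BackgroundPropagators] ((3.17)–(3.19) p.393); CMP **98** (1985) 17–51 [Balaban1985Averaging] ((8)–(9) p.18, pp.24–25, (52)–(53) p.27).
-/

set_option autoImplicit false

noncomputable section

open scoped BigOperators

namespace Summit.QuantumFields.YangMills.Theorems.Prop7CovariantTentPointwise

open Literature.MathematicalPhysics.QuantumFieldTheory.Balaban1983to89
open B7Prop1Explicit (U1 mem_U1 norm_inv_sub_one_le)
open B7Eq78Linearization (conjR conjR_apply conjR_add conjR_sub conjR_smul_real)
open B8Ineq132 (conjR_conjR conjR_sum norm_conjR_le)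
open B8Eq143PlaqExpansion (norm_conjR_sub_self_le)

variable {𝔸 : Type*} [NormedRing 𝔸] [NormOneClass 𝔸] [NormedAlgebra ℂ 𝔸]

/-! ## §1 Three small tools on `U1` -/

omit [NormedAlgebra ℂ 𝔸] in
/-- `‖Ad(u)X − Ad(p)X‖ ≤ 2‖u − p‖·‖X‖` for `u, p ∈ U1` (`Ad(u)X − Ad(p)X = Ad(p)(Ad(p⁻¹u)X − X)`, `‖p⁻¹u − 1‖ ≤ ‖u − p‖`). [folklore; cite: Balaban1985Averaging, (8)-(9) p.18] -/
theorem norm_conjR_sub_conjR_le {u p : 𝔸ˣ} (hu : u ∈ U1 𝔸) (hp : p ∈ U1 𝔸) (X : 𝔸) :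
    ‖conjR u X - conjR p X‖ ≤ 2 * ‖(u : 𝔸) - p‖ * ‖X‖ := by
  have hkey : conjR u X - conjR p X = conjR p (conjR (p⁻¹ * u) X - X) := by
    rw [conjR_sub, conjR_conjR, mul_inv_cancel_left]
  have hmem : p⁻¹ * u ∈ U1 𝔸 := (U1 𝔸).mul_mem ((U1 𝔸).inv_mem hp) hu
  have hnear : ‖((p⁻¹ * u : 𝔸ˣ) : 𝔸) - 1‖ ≤ ‖(u : 𝔸) - p‖ := by
    have h1 : ((p⁻¹ * u : 𝔸ˣ) : 𝔸) - 1 = ((p⁻¹ : 𝔸ˣ) : 𝔸) * ((u : 𝔸) - p) := by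
      rw [Units.val_mul, mul_sub, Units.inv_mul]
    rw [h1]
    calc _ ≤ ‖((p⁻¹ : 𝔸ˣ) : 𝔸)‖ * ‖(u : 𝔸) - p‖ := norm_mul_le _ _
      _ ≤ 1 * ‖(u : 𝔸) - p‖ := by gcongr; exact (mem_U1.1 hp).2
      _ = _ := one_mul _
  rw [hkey]
  calc _ ≤ ‖conjR (p⁻¹ * u) X - X‖ := norm_conjR_le hp _
    _ ≤ 2 * ‖((p⁻¹ * u : 𝔸ˣ) : 𝔸) - 1‖ * ‖X‖ := norm_conjR_sub_self_le hmem X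
    _ ≤ 2 * ‖(u : 𝔸) - p‖ * ‖X‖ := by gcongr

omit [NormOneClass 𝔸] [NormedAlgebra ℂ 𝔸] in
/-- Chaining: `‖a·b − p‖ ≤ ‖a − 1‖ + ‖b − p‖` when `‖b‖ ≤ 1` (`ab − p = (a − 1)b + (b − p)`). [folklore] -/
theorem norm_mul_sub_le_add {a b p : 𝔸} (hb : ‖b‖ ≤ 1) : ‖a * b - p‖ ≤ ‖a - 1‖ + ‖b - p‖ := by
  have h : a * b - p = (a - 1) * b + (b - p) := by noncomm_ring
  rw [h]
  calc _ ≤ ‖(a - 1) * b‖ + ‖b - p‖ := norm_add_le _ _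
    _ ≤ ‖a - 1‖ * ‖b‖ + ‖b - p‖ := by gcongr; exact norm_mul_le _ _
    _ ≤ ‖a - 1‖ * 1 + ‖b - p‖ := by gcongr
    _ = _ := by rw [mul_one]

omit [NormOneClass 𝔸] in
/-- Reference subtraction under equal total weights: `Σ_S (β_t − β_s)•v = Σ_S (β_t − β_s)•(v − R)`. [folklore] -/
theorem sum_smul_sub_ref {ι : Type*} (S : Finset ι) (βs βt : ι → ℝ) (hsum : ∑ y ∈ S, βt y = ∑ y ∈ S, βs y) (v : ι → 𝔸) (R : 𝔸) :
    ∑ y ∈ S, (βt y - βs y) • v y = ∑ y ∈ S, (βt y - βs y) • (v y - R) := by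
  have h0 : ∑ y ∈ S, (βt y - βs y) = 0 := by rw [Finset.sum_sub_distrib, hsum, sub_self]
  simp only [smul_sub, Finset.sum_sub_distrib, ← Finset.sum_smul, h0, zero_smul, sub_zero]

omit [NormedAlgebra ℂ 𝔸] in
/-- Moving a `U1` transporter across a difference: `‖Ad(A)⁻¹X − Y‖ = ‖Ad(A)Y − X‖`. [folklore; cite: Balaban1985Averaging, (8)-(9) p.18] -/
theorem norm_conjR_inv_sub_eq {A : 𝔸ˣ} (hA : A ∈ U1 𝔸) (X Y : 𝔸) : ‖conjR A⁻¹ X - Y‖ = ‖conjR A Y - X‖ := by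
  have h : conjR A (conjR A⁻¹ X - Y) = -(conjR A Y - X) := by rw [conjR_sub, conjR_conjR, mul_inv_cancel, conjR_apply, Units.val_one, inv_one, Units.val_one, one_mul, mul_one, neg_sub]
  rw [← B8Ineq132.norm_conjR hA (conjR A⁻¹ X - Y), h, norm_neg]

omit [NormedAlgebra ℂ 𝔸] in
/-- ★ **COARSE-PATH TELESCOPING, two steps**: `‖Ad(AB)⁻¹X − Z‖ ≤ ‖Ad(A)Y − X‖ + ‖Ad(B)Z − Y‖` for `A, B ∈ U1` — the transporter of a two-bond coarse path against the two
one-bond covariant differences (at the member: `A, B` the (B3) transporters `T c₁, T c₂`). [folklore; cite: Balaban1985Averaging, (8)-(9) p.18] -/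
theorem norm_conjR_inv_mul_sub_le {A B : 𝔸ˣ} (hA : A ∈ U1 𝔸) (hB : B ∈ U1 𝔸) (X Y Z : 𝔸) :
    ‖conjR (A * B)⁻¹ X - Z‖ ≤ ‖conjR A Y - X‖ + ‖conjR B Z - Y‖ := by
  have h : conjR (A * B)⁻¹ X - Z = conjR B⁻¹ (conjR A⁻¹ X - Y) + (conjR B⁻¹ Y - Z) := by
    rw [conjR_sub, conjR_conjR, mul_inv_rev]; abel
  rw [h]
  calc _ ≤ ‖conjR B⁻¹ (conjR A⁻¹ X - Y)‖ + ‖conjR B⁻¹ Y - Z‖ := norm_add_le _ _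
    _ ≤ ‖conjR A⁻¹ X - Y‖ + ‖conjR B⁻¹ Y - Z‖ := by gcongr; exact norm_conjR_le ((U1 𝔸).inv_mem hB) _
    _ = _ := by rw [norm_conjR_inv_sub_eq hA, norm_conjR_inv_sub_eq hB]

omit [NormedAlgebra ℂ 𝔸] in
/-- ★ **COARSE-PATH TELESCOPING, three steps**: `‖Ad(ABC)⁻¹X − T‖ ≤ ‖Ad(A)Y − X‖ + ‖Ad(B)Z − Y‖ + ‖Ad(C)T − Z‖`. [folklore; cite: Balaban1985Averaging, (8)-(9) p.18] -/
theorem norm_conjR_inv_mul₃_sub_le {A B C : 𝔸ˣ} (hA : A ∈ U1 𝔸) (hB : B ∈ U1 𝔸) (hC : C ∈ U1 𝔸) (X Y Z T : 𝔸) :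
    ‖conjR (A * B * C)⁻¹ X - T‖ ≤ ‖conjR A Y - X‖ + ‖conjR B Z - Y‖ + ‖conjR C T - Z‖ := by
  calc _ ≤ ‖conjR (A * B) Z - X‖ + ‖conjR C T - Z‖ := norm_conjR_inv_mul_sub_le ((U1 𝔸).mul_mem hA hB) hC X Z T
    _ ≤ _ := by
        gcongr
        rw [← norm_conjR_inv_sub_eq ((U1 𝔸).mul_mem hA hB)]
        exact norm_conjR_inv_mul_sub_le hA hB X Y Z

/-! ## §2 The per-bond gradient row -/

section Gradient

variable {ι : Type*}

omit [NormOneClass 𝔸] in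
/-- ★★ **THE COVARIANT DIFFERENCE OF THE TENT VALUE ACROSS ONE FINE BOND — IDENTITY.**  With `h y := g_s y · W_b · (g_t y)⁻¹` (the bond variable in the frame of block `y`):
`Ad(W_b)(Σ β_t y•Ad(g_t y)⁻¹ w y) − Σ β_s y•Ad(g_s y)⁻¹ w y = Σ (β_t y − β_s y)•Ad(g_s y)⁻¹ w y + Σ β_t y•Ad(g_s y)⁻¹(Ad(h y) w y − w y)`.
[cite: Balaban1985Averaging, (8)-(9) p.18] -/
theorem covTent_grad_identity (S : Finset ι) (βs βt : ι → ℝ) (gs gt : ι → 𝔸ˣ) (Wb : 𝔸ˣ) (w : ι → 𝔸) :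
    conjR Wb (∑ y ∈ S, βt y • conjR (gt y)⁻¹ (w y)) - ∑ y ∈ S, βs y • conjR (gs y)⁻¹ (w y)
      = ∑ y ∈ S, (βt y - βs y) • conjR (gs y)⁻¹ (w y)
        + ∑ y ∈ S, βt y • conjR (gs y)⁻¹ (conjR (gs y * Wb * (gt y)⁻¹) (w y) - w y) := by
  rw [conjR_sum, ← Finset.sum_sub_distrib, ← Finset.sum_add_distrib]
  refine Finset.sum_congr rfl fun y _ => ?_
  rw [conjR_smul_real, conjR_conjR, conjR_sub, conjR_conjR, show (gs y)⁻¹ * (gs y * Wb * (gt y)⁻¹) = Wb * (gt y)⁻¹ by group, sub_smul, smul_sub]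
  abel

/-- ★★★ **THE PER-BOND GRADIENT ROW OF THE COVARIANT TENT.**  Frames, bond variable and coarse transporters in `U1`; equal total weights at the two ends (`Σβ_t = Σβ_s`, a p.o.u.);
`β_t ≥ 0`; THIN defects `‖g_s y·W_b·(g_t y)⁻¹ − 1‖ ≤ θ₁`, FAT defects `‖g_s y₀·(g_s y)⁻¹ − P y‖ ≤ θ₂` relative to a reference block `y₀`.  Then
`‖Ad(W_b)(I w)(t) − (I w)(s)‖ ≤ Σ_y |β_t y − β_s y|·(‖Ad(P y) w y − w y₀‖ + 2θ₂‖w y‖) + 2θ₁·Σ_y β_t y·‖w y‖`. [cite: Balaban1985Averaging, pp.24-25, (52)-(53) p.27] -/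
theorem norm_covTent_grad_le (S : Finset ι) (βs βt : ι → ℝ) (gs gt : ι → 𝔸ˣ) (Wb : 𝔸ˣ) (w : ι → 𝔸) (y₀ : ι) (P : ι → 𝔸ˣ) {θ₁ θ₂ : ℝ}
    (hsum : ∑ y ∈ S, βt y = ∑ y ∈ S, βs y) (hβt : ∀ y ∈ S, 0 ≤ βt y)
    (hgs : ∀ y ∈ S, gs y ∈ U1 𝔸) (hgt : ∀ y ∈ S, gt y ∈ U1 𝔸) (hWb : Wb ∈ U1 𝔸) (hP : ∀ y ∈ S, P y ∈ U1 𝔸) (hy₀ : gs y₀ ∈ U1 𝔸)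
    (hthin : ∀ y ∈ S, ‖((gs y * Wb * (gt y)⁻¹ : 𝔸ˣ) : 𝔸) - 1‖ ≤ θ₁)
    (hfat : ∀ y ∈ S, ‖((gs y₀ * (gs y)⁻¹ : 𝔸ˣ) : 𝔸) - P y‖ ≤ θ₂) :
    ‖conjR Wb (∑ y ∈ S, βt y • conjR (gt y)⁻¹ (w y)) - ∑ y ∈ S, βs y • conjR (gs y)⁻¹ (w y)‖
      ≤ ∑ y ∈ S, |βt y - βs y| * (‖conjR (P y) (w y) - w y₀‖ + 2 * θ₂ * ‖w y‖) + 2 * θ₁ * ∑ y ∈ S, βt y * ‖w y‖ := by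
  rw [covTent_grad_identity, sum_smul_sub_ref S βs βt hsum _ (conjR (gs y₀)⁻¹ (w y₀))]
  refine (norm_add_le _ _).trans (add_le_add ?_ ?_)
  · refine (norm_sum_le _ _).trans (Finset.sum_le_sum fun y hy => ?_)
    rw [norm_smul, Real.norm_eq_abs]
    refine mul_le_mul_of_nonneg_left ?_ (abs_nonneg _)
    -- `Ad(g_s y)⁻¹ w y − Ad(g_s y₀)⁻¹ w y₀ = Ad(g_s y₀)⁻¹ (Ad(g_s y₀ (g_s y)⁻¹) w y − w y₀)`
    have hid : conjR (gs y)⁻¹ (w y) - conjR (gs y₀)⁻¹ (w y₀) = conjR (gs y₀)⁻¹ (conjR (gs y₀ * (gs y)⁻¹) (w y) - w y₀) := by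
      rw [conjR_sub, conjR_conjR, inv_mul_cancel_left]
    rw [hid]
    calc _ ≤ ‖conjR (gs y₀ * (gs y)⁻¹) (w y) - w y₀‖ := norm_conjR_le ((U1 𝔸).inv_mem hy₀) _
      _ ≤ ‖conjR (gs y₀ * (gs y)⁻¹) (w y) - conjR (P y) (w y)‖ + ‖conjR (P y) (w y) - w y₀‖ := norm_sub_le_norm_sub_add_norm_sub _ _ _
      _ ≤ 2 * θ₂ * ‖w y‖ + ‖conjR (P y) (w y) - w y₀‖ := by
          gcongr
          calc _ ≤ 2 * ‖((gs y₀ * (gs y)⁻¹ : 𝔸ˣ) : 𝔸) - P y‖ * ‖w y‖ :=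
                norm_conjR_sub_conjR_le ((U1 𝔸).mul_mem hy₀ ((U1 𝔸).inv_mem (hgs y hy))) (hP y hy) _
            _ ≤ 2 * θ₂ * ‖w y‖ := by gcongr; exact hfat y hy
      _ = _ := add_comm _ _
  · rw [Finset.mul_sum]
    refine (norm_sum_le _ _).trans (Finset.sum_le_sum fun y hy => ?_)
    rw [norm_smul, Real.norm_eq_abs, abs_of_nonneg (hβt y hy)]
    have hmem : gs y * Wb * (gt y)⁻¹ ∈ U1 𝔸 := (U1 𝔸).mul_mem ((U1 𝔸).mul_mem (hgs y hy) hWb) ((U1 𝔸).inv_mem (hgt y hy))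
    calc βt y * ‖conjR (gs y)⁻¹ (conjR (gs y * Wb * (gt y)⁻¹) (w y) - w y)‖
        ≤ βt y * ‖conjR (gs y * Wb * (gt y)⁻¹) (w y) - w y‖ := mul_le_mul_of_nonneg_left (norm_conjR_le ((U1 𝔸).inv_mem (hgs y hy)) _) (hβt y hy)
      _ ≤ βt y * (2 * ‖((gs y * Wb * (gt y)⁻¹ : 𝔸ˣ) : 𝔸) - 1‖ * ‖w y‖) := mul_le_mul_of_nonneg_left (norm_conjR_sub_self_le hmem _) (hβt y hy)
      _ ≤ βt y * (2 * θ₁ * ‖w y‖) := by gcongr; exacts [hβt y hy, hthin y hy]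
      _ = 2 * θ₁ * (βt y * ‖w y‖) := by ring

end Gradient

/-! ## §3 The per-block reproduction row -/

section Reproduction

variable {ι κ : Type*}

/-- ★★ **THE REPRODUCTION DEFECT OF A TRANSPORTED BLOCK AVERAGE OF THE COVARIANT TENT.**  Block sites `x ∈ X` with convex weights `ω` (`Σω = 1`, `ω ≥ 0`; print's `L^{−kd}`), block
transporters `τ x ∈ U1` (print's composite comb transporter `U(Γ^{(k)}_{y₀,x})`), at every block site a p.o.u. `β x ·` over `S` (`Σ_y β x y = 1`, `0 ≤ β ≤ 1`) and frames `g y x ∈ U1`;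
REPRODUCTION defects `‖τ x·(g y₀ x)⁻¹ − 1‖ ≤ θ₃` (comb vs one-shot axial transport, the (B2a-F3) row) and FAT defects `‖g y₀ x·(g y x)⁻¹ − P y‖ ≤ θ₂`.  Then
`‖w y₀ − Σ_x ω x•Ad(τ x)(Σ_y β x y•Ad(g y x)⁻¹ w y)‖ ≤ Σ_x ω x·Σ_y β x y·(‖Ad(P y) w y − w y₀‖ + 2(θ₂ + θ₃)‖w y‖)`.
[cite: Balaban1985BackgroundPropagators, (3.19) p.393; Balaban1985Averaging, (52)-(53) p.27] -/
theorem norm_sub_avg_covTent_le (X : Finset κ) (ω : κ → ℝ) (hω0 : ∀ x ∈ X, 0 ≤ ω x) (hω1 : ∑ x ∈ X, ω x = 1) (τ : κ → 𝔸ˣ) (hτ : ∀ x ∈ X, τ x ∈ U1 𝔸)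
    (S : Finset ι) (β : κ → ι → ℝ) (hβ0 : ∀ x ∈ X, ∀ y ∈ S, 0 ≤ β x y) (hβ1 : ∀ x ∈ X, ∑ y ∈ S, β x y = 1)
    (g : ι → κ → 𝔸ˣ) (hg : ∀ y ∈ S, ∀ x ∈ X, g y x ∈ U1 𝔸) (y₀ : ι) (hy₀ : ∀ x ∈ X, g y₀ x ∈ U1 𝔸) (P : ι → 𝔸ˣ) (hP : ∀ y ∈ S, P y ∈ U1 𝔸) {θ₂ θ₃ : ℝ}
    (hrep : ∀ x ∈ X, ‖((τ x * (g y₀ x)⁻¹ : 𝔸ˣ) : 𝔸) - 1‖ ≤ θ₃)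
    (hfat : ∀ x ∈ X, ∀ y ∈ S, ‖((g y₀ x * (g y x)⁻¹ : 𝔸ˣ) : 𝔸) - P y‖ ≤ θ₂) (w : ι → 𝔸) :
    ‖w y₀ - ∑ x ∈ X, ω x • conjR (τ x) (∑ y ∈ S, β x y • conjR (g y x)⁻¹ (w y))‖
      ≤ ∑ x ∈ X, ω x * ∑ y ∈ S, β x y * (‖conjR (P y) (w y) - w y₀‖ + 2 * (θ₂ + θ₃) * ‖w y‖) := by
  -- write `w y₀` as the same double convex combination of itself
  have hw : w y₀ = ∑ x ∈ X, ω x • ∑ y ∈ S, β x y • w y₀ := by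
    have : ∀ x ∈ X, ω x • ∑ y ∈ S, β x y • w y₀ = ω x • w y₀ := fun x hx => by rw [← Finset.sum_smul, hβ1 x hx, one_smul]
    rw [Finset.sum_congr rfl this, ← Finset.sum_smul, hω1, one_smul]
  have hrw : w y₀ - ∑ x ∈ X, ω x • conjR (τ x) (∑ y ∈ S, β x y • conjR (g y x)⁻¹ (w y))
      = ∑ x ∈ X, ω x • ∑ y ∈ S, β x y • (w y₀ - conjR (τ x * (g y x)⁻¹) (w y)) := by
    conv_lhs => rw [hw]
    rw [← Finset.sum_sub_distrib]
    refine Finset.sum_congr rfl fun x _ => ?_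
    rw [conjR_sum, ← smul_sub, ← Finset.sum_sub_distrib]
    congr 1
    refine Finset.sum_congr rfl fun y _ => ?_
    rw [conjR_smul_real, conjR_conjR, smul_sub]
  rw [hrw]
  refine (norm_sum_le _ _).trans (Finset.sum_le_sum fun x hx => ?_)
  rw [norm_smul, Real.norm_eq_abs, abs_of_nonneg (hω0 x hx)]
  refine mul_le_mul_of_nonneg_left ((norm_sum_le _ _).trans (Finset.sum_le_sum fun y hy => ?_)) (hω0 x hx)
  rw [norm_smul, Real.norm_eq_abs, abs_of_nonneg (hβ0 x hx y hy)]
  refine mul_le_mul_of_nonneg_left ?_ (hβ0 x hx y hy)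
  -- `u := τ x (g y x)⁻¹` is `(θ₂ + θ₃)`-close to `P y`
  have hu : τ x * (g y x)⁻¹ ∈ U1 𝔸 := (U1 𝔸).mul_mem (hτ x hx) ((U1 𝔸).inv_mem (hg y hy x hx))
  have hclose : ‖((τ x * (g y x)⁻¹ : 𝔸ˣ) : 𝔸) - P y‖ ≤ θ₃ + θ₂ := by
    have hsplit : ((τ x * (g y x)⁻¹ : 𝔸ˣ) : 𝔸) = ((τ x * (g y₀ x)⁻¹ : 𝔸ˣ) : 𝔸) * ((g y₀ x * (g y x)⁻¹ : 𝔸ˣ) : 𝔸) := by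
      rw [← Units.val_mul]; congr 1; group
    rw [hsplit]
    have hb : ‖((g y₀ x * (g y x)⁻¹ : 𝔸ˣ) : 𝔸)‖ ≤ 1 := (mem_U1.1 ((U1 𝔸).mul_mem (hy₀ x hx) ((U1 𝔸).inv_mem (hg y hy x hx)))).1
    exact (norm_mul_sub_le_add hb).trans (add_le_add (hrep x hx) (hfat x hx y hy))
  rw [norm_sub_rev]
  calc ‖conjR (τ x * (g y x)⁻¹) (w y) - w y₀‖
      ≤ ‖conjR (τ x * (g y x)⁻¹) (w y) - conjR (P y) (w y)‖ + ‖conjR (P y) (w y) - w y₀‖ := norm_sub_le_norm_sub_add_norm_sub _ _ _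
    _ ≤ 2 * ‖((τ x * (g y x)⁻¹ : 𝔸ˣ) : 𝔸) - P y‖ * ‖w y‖ + ‖conjR (P y) (w y) - w y₀‖ := by
        gcongr; exact norm_conjR_sub_conjR_le hu (hP y hy) _
    _ ≤ 2 * (θ₃ + θ₂) * ‖w y‖ + ‖conjR (P y) (w y) - w y₀‖ := by gcongr
    _ = _ := by rw [add_comm (θ₃ : ℝ)]; ring

end Reproduction

/-! ## §4 The pointwise size row -/

section Size

variable {ι : Type*}

/-- ★ **SIZE OF THE TENT VALUE**: `‖Σ_y β y•Ad(g y)⁻¹ w y‖ ≤ Σ_y β y·‖w y‖` (`β ≥ 0`, frames in `U1`). [cite: Balaban1985Averaging, (8)-(9) p.18] -/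
theorem norm_covTent_le (S : Finset ι) (β : ι → ℝ) (hβ : ∀ y ∈ S, 0 ≤ β y) (g : ι → 𝔸ˣ) (hg : ∀ y ∈ S, g y ∈ U1 𝔸) (w : ι → 𝔸) :
    ‖∑ y ∈ S, β y • conjR (g y)⁻¹ (w y)‖ ≤ ∑ y ∈ S, β y * ‖w y‖ := by
  refine (norm_sum_le _ _).trans (Finset.sum_le_sum fun y hy => ?_)
  rw [norm_smul, Real.norm_eq_abs, abs_of_nonneg (hβ y hy)]
  exact mul_le_mul_of_nonneg_left (norm_conjR_le ((U1 𝔸).inv_mem (hg y hy)) _) (hβ y hy)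

end Size

/-! ## §5 Squared forms (Jensen ∕ Cauchy–Schwarz), in the shape summed at the member -/

section Squares

variable {ι κ : Type*}

/-- `(Σ_S c y·a y)² ≤ sl²·|S|·Σ_S (a y)²` when `|c y| ≤ sl`. [folklore] -/
theorem sq_sum_mul_le_of_abs_le (S : Finset ι) (c a : ι → ℝ) {sl : ℝ} (hc : ∀ y ∈ S, |c y| ≤ sl) :
    (∑ y ∈ S, c y * a y) ^ 2 ≤ sl ^ 2 * S.card * ∑ y ∈ S, a y ^ 2 := by
  have hcy : ∀ y ∈ S, c y ^ 2 ≤ sl ^ 2 := fun y hy => by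
    rw [← sq_abs (c y)]; exact pow_le_pow_left₀ (abs_nonneg _) (hc y hy) 2
  have ha : 0 ≤ ∑ y ∈ S, a y ^ 2 := Finset.sum_nonneg fun y _ => sq_nonneg _
  calc (∑ y ∈ S, c y * a y) ^ 2 ≤ (∑ y ∈ S, c y ^ 2) * ∑ y ∈ S, a y ^ 2 := Finset.sum_mul_sq_le_sq_mul_sq S c a
    _ ≤ (∑ y ∈ S, sl ^ 2) * ∑ y ∈ S, a y ^ 2 := mul_le_mul_of_nonneg_right (Finset.sum_le_sum hcy) ha
    _ = sl ^ 2 * S.card * ∑ y ∈ S, a y ^ 2 := by rw [Finset.sum_const, nsmul_eq_mul]; ring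

/-- Jensen for convex weights: `(Σ_S β y·a y)² ≤ Σ_S β y·(a y)²` when `β ≥ 0`, `Σβ = 1`. [folklore] -/
theorem sq_sum_convex_le (S : Finset ι) (β a : ι → ℝ) (hβ : ∀ y ∈ S, 0 ≤ β y) (hβ1 : ∑ y ∈ S, β y = 1) :
    (∑ y ∈ S, β y * a y) ^ 2 ≤ ∑ y ∈ S, β y * a y ^ 2 := by
  have h := Finset.sum_mul_sq_le_sq_mul_sq S (fun y => Real.sqrt (β y)) (fun y => Real.sqrt (β y) * a y)
  have h1 : ∀ y ∈ S, Real.sqrt (β y) * (Real.sqrt (β y) * a y) = β y * a y := fun y hy => by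
    rw [← mul_assoc, Real.mul_self_sqrt (hβ y hy)]
  have h2 : ∀ y ∈ S, Real.sqrt (β y) ^ 2 = β y := fun y hy => Real.sq_sqrt (hβ y hy)
  have h3 : ∀ y ∈ S, (Real.sqrt (β y) * a y) ^ 2 = β y * a y ^ 2 := fun y hy => by rw [mul_pow, Real.sq_sqrt (hβ y hy)]
  rw [Finset.sum_congr rfl h1, Finset.sum_congr rfl h2, Finset.sum_congr rfl h3, hβ1, one_mul] at h
  exact h

/-- Jensen for sub-convex weights: `(Σ_S β y·a y)² ≤ Σ_S β y·(a y)²` when `β ≥ 0`, `Σβ ≤ 1`, `a ≥ 0`-free. [folklore] -/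
theorem sq_sum_subconvex_le (S : Finset ι) (β a : ι → ℝ) (hβ : ∀ y ∈ S, 0 ≤ β y) (hβ1 : ∑ y ∈ S, β y ≤ 1) :
    (∑ y ∈ S, β y * a y) ^ 2 ≤ ∑ y ∈ S, β y * a y ^ 2 := by
  have h := Finset.sum_mul_sq_le_sq_mul_sq S (fun y => Real.sqrt (β y)) (fun y => Real.sqrt (β y) * a y)
  have h1 : ∀ y ∈ S, Real.sqrt (β y) * (Real.sqrt (β y) * a y) = β y * a y := fun y hy => by
    rw [← mul_assoc, Real.mul_self_sqrt (hβ y hy)]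
  have h2 : ∀ y ∈ S, Real.sqrt (β y) ^ 2 = β y := fun y hy => Real.sq_sqrt (hβ y hy)
  have h3 : ∀ y ∈ S, (Real.sqrt (β y) * a y) ^ 2 = β y * a y ^ 2 := fun y hy => by rw [mul_pow, Real.sq_sqrt (hβ y hy)]
  rw [Finset.sum_congr rfl h1, Finset.sum_congr rfl h2, Finset.sum_congr rfl h3] at h
  have hnn : 0 ≤ ∑ y ∈ S, β y * a y ^ 2 := Finset.sum_nonneg fun y hy => mul_nonneg (hβ y hy) (sq_nonneg _)
  calc _ ≤ (∑ y ∈ S, β y) * ∑ y ∈ S, β y * a y ^ 2 := h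
    _ ≤ 1 * ∑ y ∈ S, β y * a y ^ 2 := mul_le_mul_of_nonneg_right hβ1 hnn
    _ = _ := one_mul _

/-- ★ **THE PER-BOND GRADIENT ROW, SQUARED**: with slopes `|β_t − β_s| ≤ sl` on `S` and `Σβ_t = 1`,
`‖Ad(W_b)(I w)(t) − (I w)(s)‖² ≤ 4·sl²·|S|·Σ_y‖Ad(P y)w y − w y₀‖² + 16·sl²·|S|·θ₂²·Σ_y‖w y‖² + 8·θ₁²·Σ_y β_t y·‖w y‖²`.
[cite: Balaban1985Averaging, pp.24-25, (52)-(53) p.27] -/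
theorem norm_sq_covTent_grad_le (S : Finset ι) (βs βt : ι → ℝ) (gs gt : ι → 𝔸ˣ) (Wb : 𝔸ˣ) (w : ι → 𝔸) (y₀ : ι) (P : ι → 𝔸ˣ) {θ₁ θ₂ sl : ℝ}
    (hsum_s : ∑ y ∈ S, βs y = 1) (hsum_t : ∑ y ∈ S, βt y = 1) (hβt : ∀ y ∈ S, 0 ≤ βt y) (hsl : ∀ y ∈ S, |βt y - βs y| ≤ sl)
    (hgs : ∀ y ∈ S, gs y ∈ U1 𝔸) (hgt : ∀ y ∈ S, gt y ∈ U1 𝔸) (hWb : Wb ∈ U1 𝔸) (hP : ∀ y ∈ S, P y ∈ U1 𝔸) (hy₀ : gs y₀ ∈ U1 𝔸)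
    (hthin : ∀ y ∈ S, ‖((gs y * Wb * (gt y)⁻¹ : 𝔸ˣ) : 𝔸) - 1‖ ≤ θ₁)
    (hfat : ∀ y ∈ S, ‖((gs y₀ * (gs y)⁻¹ : 𝔸ˣ) : 𝔸) - P y‖ ≤ θ₂) :
    ‖conjR Wb (∑ y ∈ S, βt y • conjR (gt y)⁻¹ (w y)) - ∑ y ∈ S, βs y • conjR (gs y)⁻¹ (w y)‖ ^ 2
      ≤ 4 * sl ^ 2 * S.card * ∑ y ∈ S, ‖conjR (P y) (w y) - w y₀‖ ^ 2 + 16 * sl ^ 2 * S.card * θ₂ ^ 2 * ∑ y ∈ S, ‖w y‖ ^ 2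
        + 8 * θ₁ ^ 2 * ∑ y ∈ S, βt y * ‖w y‖ ^ 2 := by
  have h := norm_covTent_grad_le S βs βt gs gt Wb w y₀ P (hsum_t.trans hsum_s.symm) hβt hgs hgt hWb hP hy₀ hthin hfat
  set A : ℝ := ∑ y ∈ S, |βt y - βs y| * (‖conjR (P y) (w y) - w y₀‖ + 2 * θ₂ * ‖w y‖)
  set B : ℝ := ∑ y ∈ S, βt y * ‖w y‖
  have hA : A ^ 2 ≤ sl ^ 2 * S.card * ∑ y ∈ S, (‖conjR (P y) (w y) - w y₀‖ + 2 * θ₂ * ‖w y‖) ^ 2 :=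
    sq_sum_mul_le_of_abs_le S _ _ fun y hy => by rw [abs_abs]; exact hsl y hy
  have hA' : ∑ y ∈ S, (‖conjR (P y) (w y) - w y₀‖ + 2 * θ₂ * ‖w y‖) ^ 2
      ≤ 2 * ∑ y ∈ S, ‖conjR (P y) (w y) - w y₀‖ ^ 2 + 8 * θ₂ ^ 2 * ∑ y ∈ S, ‖w y‖ ^ 2 := by
    rw [Finset.mul_sum, Finset.mul_sum, ← Finset.sum_add_distrib]
    exact Finset.sum_le_sum fun y _ => by nlinarith [sq_nonneg (‖conjR (P y) (w y) - w y₀‖ - 2 * θ₂ * ‖w y‖)]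
  have hB : B ^ 2 ≤ ∑ y ∈ S, βt y * ‖w y‖ ^ 2 := sq_sum_convex_le S βt _ hβt hsum_t
  have hnn : 0 ≤ ‖conjR Wb (∑ y ∈ S, βt y • conjR (gt y)⁻¹ (w y)) - ∑ y ∈ S, βs y • conjR (gs y)⁻¹ (w y)‖ := norm_nonneg _
  have hcard : (0 : ℝ) ≤ sl ^ 2 * S.card := by positivity
  calc _ ≤ (A + 2 * θ₁ * B) ^ 2 := pow_le_pow_left₀ hnn h 2
    _ ≤ 2 * A ^ 2 + 2 * (2 * θ₁ * B) ^ 2 := by nlinarith [sq_nonneg (A - 2 * θ₁ * B)]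
    _ = 2 * A ^ 2 + 8 * θ₁ ^ 2 * B ^ 2 := by ring
    _ ≤ 2 * (sl ^ 2 * S.card * (2 * ∑ y ∈ S, ‖conjR (P y) (w y) - w y₀‖ ^ 2 + 8 * θ₂ ^ 2 * ∑ y ∈ S, ‖w y‖ ^ 2))
          + 8 * θ₁ ^ 2 * ∑ y ∈ S, βt y * ‖w y‖ ^ 2 := by
        gcongr
        exact hA.trans (mul_le_mul_of_nonneg_left hA' hcard)
    _ = _ := by ring

/-- ★ **THE REPRODUCTION ROW, SQUARED**: under the hypotheses of `norm_sub_avg_covTent_le` with `β x y ≤ 1`,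
`‖w y₀ − (average)‖² ≤ 2·|S|·Σ_y‖Ad(P y)w y − w y₀‖² + 8·|S|·(θ₂ + θ₃)²·Σ_y‖w y‖²`. [cite: Balaban1985BackgroundPropagators, (3.19) p.393] -/
theorem norm_sq_sub_avg_covTent_le (X : Finset κ) (ω : κ → ℝ) (hω0 : ∀ x ∈ X, 0 ≤ ω x) (hω1 : ∑ x ∈ X, ω x = 1) (τ : κ → 𝔸ˣ) (hτ : ∀ x ∈ X, τ x ∈ U1 𝔸)
    (S : Finset ι) (β : κ → ι → ℝ) (hβ0 : ∀ x ∈ X, ∀ y ∈ S, 0 ≤ β x y) (hβle : ∀ x ∈ X, ∀ y ∈ S, β x y ≤ 1) (hβ1 : ∀ x ∈ X, ∑ y ∈ S, β x y = 1)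
    (g : ι → κ → 𝔸ˣ) (hg : ∀ y ∈ S, ∀ x ∈ X, g y x ∈ U1 𝔸) (y₀ : ι) (hy₀ : ∀ x ∈ X, g y₀ x ∈ U1 𝔸) (P : ι → 𝔸ˣ) (hP : ∀ y ∈ S, P y ∈ U1 𝔸) {θ₂ θ₃ : ℝ}
    (hθ : 0 ≤ θ₂ + θ₃)
    (hrep : ∀ x ∈ X, ‖((τ x * (g y₀ x)⁻¹ : 𝔸ˣ) : 𝔸) - 1‖ ≤ θ₃)
    (hfat : ∀ x ∈ X, ∀ y ∈ S, ‖((g y₀ x * (g y x)⁻¹ : 𝔸ˣ) : 𝔸) - P y‖ ≤ θ₂) (w : ι → 𝔸) :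
    ‖w y₀ - ∑ x ∈ X, ω x • conjR (τ x) (∑ y ∈ S, β x y • conjR (g y x)⁻¹ (w y))‖ ^ 2
      ≤ 2 * S.card * ∑ y ∈ S, ‖conjR (P y) (w y) - w y₀‖ ^ 2 + 8 * S.card * (θ₂ + θ₃) ^ 2 * ∑ y ∈ S, ‖w y‖ ^ 2 := by
  have h := norm_sub_avg_covTent_le X ω hω0 hω1 τ hτ S β hβ0 hβ1 g hg y₀ hy₀ P hP hrep hfat w
  -- the inner sums are bounded by the β-free sum `M`
  set M : ℝ := ∑ y ∈ S, (‖conjR (P y) (w y) - w y₀‖ + 2 * (θ₂ + θ₃) * ‖w y‖)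
  have hterm : ∀ y ∈ S, 0 ≤ ‖conjR (P y) (w y) - w y₀‖ + 2 * (θ₂ + θ₃) * ‖w y‖ := fun y _ => by positivity
  have hinner : ∀ x ∈ X, ∑ y ∈ S, β x y * (‖conjR (P y) (w y) - w y₀‖ + 2 * (θ₂ + θ₃) * ‖w y‖) ≤ M := fun x hx =>
    Finset.sum_le_sum fun y hy => by
      calc _ ≤ 1 * (‖conjR (P y) (w y) - w y₀‖ + 2 * (θ₂ + θ₃) * ‖w y‖) := mul_le_mul_of_nonneg_right (hβle x hx y hy) (hterm y hy)
        _ = _ := one_mul _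
  have hle : ‖w y₀ - ∑ x ∈ X, ω x • conjR (τ x) (∑ y ∈ S, β x y • conjR (g y x)⁻¹ (w y))‖ ≤ M := by
    refine h.trans ?_
    calc _ ≤ ∑ x ∈ X, ω x * M := Finset.sum_le_sum fun x hx => mul_le_mul_of_nonneg_left (hinner x hx) (hω0 x hx)
      _ = M := by rw [← Finset.sum_mul, hω1, one_mul]
  have hM : M ^ 2 ≤ S.card * ∑ y ∈ S, (‖conjR (P y) (w y) - w y₀‖ + 2 * (θ₂ + θ₃) * ‖w y‖) ^ 2 := by
    have := sq_sum_mul_le_of_abs_le S (fun _ => (1 : ℝ)) (fun y => ‖conjR (P y) (w y) - w y₀‖ + 2 * (θ₂ + θ₃) * ‖w y‖) (sl := 1)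
      (fun _ _ => by rw [abs_one])
    simp only [one_mul, one_pow] at this
    exact this
  have hM' : ∑ y ∈ S, (‖conjR (P y) (w y) - w y₀‖ + 2 * (θ₂ + θ₃) * ‖w y‖) ^ 2
      ≤ 2 * ∑ y ∈ S, ‖conjR (P y) (w y) - w y₀‖ ^ 2 + 8 * (θ₂ + θ₃) ^ 2 * ∑ y ∈ S, ‖w y‖ ^ 2 := by
    rw [Finset.mul_sum, Finset.mul_sum, ← Finset.sum_add_distrib]
    exact Finset.sum_le_sum fun y _ => by nlinarith [sq_nonneg (‖conjR (P y) (w y) - w y₀‖ - 2 * (θ₂ + θ₃) * ‖w y‖)]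
  have hcard : (0 : ℝ) ≤ S.card := by positivity
  calc _ ≤ M ^ 2 := pow_le_pow_left₀ (norm_nonneg _) hle 2
    _ ≤ S.card * (2 * ∑ y ∈ S, ‖conjR (P y) (w y) - w y₀‖ ^ 2 + 8 * (θ₂ + θ₃) ^ 2 * ∑ y ∈ S, ‖w y‖ ^ 2) := hM.trans (mul_le_mul_of_nonneg_left hM' hcard)
    _ = _ := by ring

/-- ★ **THE SIZE ROW, SQUARED**: `‖Σ_y β y•Ad(g y)⁻¹ w y‖² ≤ Σ_y β y·‖w y‖²` for convex weights. [cite: Balaban1985Averaging, (8)-(9) p.18] -/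
theorem norm_sq_covTent_le (S : Finset ι) (β : ι → ℝ) (hβ : ∀ y ∈ S, 0 ≤ β y) (hβ1 : ∑ y ∈ S, β y = 1) (g : ι → 𝔸ˣ) (hg : ∀ y ∈ S, g y ∈ U1 𝔸)
    (w : ι → 𝔸) :
    ‖∑ y ∈ S, β y • conjR (g y)⁻¹ (w y)‖ ^ 2 ≤ ∑ y ∈ S, β y * ‖w y‖ ^ 2 :=
  (pow_le_pow_left₀ (norm_nonneg _) (norm_covTent_le S β hβ g hg w) 2).trans (sq_sum_convex_le S β _ hβ hβ1)

end Squares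

end Summit.QuantumFields.YangMills.Theorems.Prop7CovariantTentPointwise

end
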